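import Summits.BirchSwinnertonDyer.BirchSwinnertonDyer.Theorems.GenusKolyvaginAtTwoTorsionCellSELNegTwistZNorm
import Summits.BirchSwinnertonDyer.BirchSwinnertonDyer.Theorems.GenusKolyvaginAtTwoTorsionCellSELNegTwistZBits
import HarnessLib

/-!
# SEL (iso-class Selmer pair law), C1-K: the base pair `(w₁, w₂)` of the odd Selmer classes of `E^{(−p₀M)}`

Crux R″ `RankOneTwoTorsionResidualAtTwo` (stmt-27478), LINE 49 «full_vertex», SUPPORT stub SEL
`IsoClassSelmerPairLawAtTwo`, the `C₁` half (LEAD memo `Cruxes/…/Lines/torsion_cell_full_vertex_SEL_C1_road_g36.md`,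
§3: the `σ = 1` classes are `z · (even explicit)`).  From the normalised extra relaxed class `z = (z_a, z_b)` of part C1-I′
(supported on `S ∪ {q₀}`, `q₀`-parities `(1+ε, ε)`, `qr_{q₀} = 0`, `z_a < 0 < z_b`) we form the BASE PAIR
`w₁ = z_a q₀^{[ε=0]}`, `w₂ = z_b q₀^{[ε=1]}`: **`exists_negTwist_base`** — units with even valuation at every prime outside `S`,
residue `0` at every prime of `Q`, residues `(1, 0)` at `p₀`, signs `(−, +)`, and such that
`c_E(w₁ ∏_{A₁} i, w₂ ∏_{A₂} i)` satisfies `E`'s local condition at the primes of `S` whenever `A₁, A₂ ⊆ Q` have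
`#A₁ ≡ 1 + ε`, `#A₂ ≡ ε (mod 2)` (it is `z` plus an even iso-class product class).

Everything is proved; no LINE 49 statement is restated; BSD is not advanced by this file alone.

## References

* [KlagsbrunMazurRubin2013] Z. Klagsbrun, B. Mazur, K. Rubin, Ann. of Math. 178 (2013), Thm. 3.9.
* [Kane2013SelmerTwists] D. M. Kane, Algebra Number Theory 7 (2013), §2.
* [SilvermanAEC2009] J. H. Silverman, *The Arithmetic of Elliptic Curves*, 2nd ed., Prop. X.1.4.
-/

noncomputable section

open scoped Classical

namespace Summit.BirchSwinnertonDyer.BirchSwinnertonDyer.Theorems.GenusKolyvaginAtTwo.TorsionCellSEL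

open WeierstrassCurve WeierstrassCurve.Affine WeierstrassCurve.Affine.Point
open Literature.NumberTheory.GaloisRepresentations Literature.NumberTheory.EllipticCurves Field
open Literature.NumberTheory.EllipticCurves.TwoDescentLocal
open Literature.NumberTheory.EllipticCurves.KramerTwoDescent
open Literature.NumberTheory.QuadraticForms
open Summit.BirchSwinnertonDyer.BirchSwinnertonDyer.Theorems.GenusKolyvaginAtTwo.TorsionCellD0
open IsDedekindDomain NumberField Rat.HeightOneSpectrum

variable (E : WeierstrassCurve ℚ) [E.IsElliptic] {e₁ e₂ e₃ : ℚ} (S Q : Finset ℕ) {q₀ p₀ : ℕ} [hq₀ : Fact q₀.Prime]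
  [hp₀ : Fact p₀.Prime]

omit hq₀ hp₀ in
/-- `q₀ · ∏_{A} i` is a square in `ℚ_v` for `v ∈ S` when `A ⊆ Q` has ODD size (`q₀ ∈ Q` iso-class). [cite: Kane2013SelmerTwists, §2] -/
private theorem isSquare_q₀_mul_prod (hQ : ∀ q ∈ Q, q.Prime) (hQS : ∀ q ∈ Q, q ∉ S) (hQ4 : ∀ q ∈ Q, q % 4 = 3)
    (hiso8 : ∀ q ∈ Q, ∀ q' ∈ Q, q % 8 = q' % 8)
    (hisoS : ∀ q ∈ Q, ∀ q' ∈ Q, ∀ ℓ ∈ S, (hℓ : ℓ.Prime) → ℓ ≠ 2 → haveI : Fact ℓ.Prime := ⟨hℓ⟩;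
      legendreSym ℓ ((q : ℤ) * q') = 1)
    (hq₀Q : q₀ ∈ Q) {A : Finset ℕ} (hA : A ⊆ Q) (hAodd : ¬ Even A.card)
    (v : HeightOneSpectrum (𝓞 ℚ)) (hvS : (primesEquiv v : ℕ) ∈ S) :
    IsSquare (algebraMap ℚ (v.adicCompletion ℚ) ((q₀ : ℚ) * ∏ i ∈ A, (i : ℚ))) := by
  by_cases hqA : q₀ ∈ A
  · rw [← Finset.mul_prod_erase A (fun i => (i : ℚ)) hqA, ← mul_assoc, map_mul]
    refine IsSquare.mul ⟨algebraMap ℚ _ (q₀ : ℚ), by rw [← map_mul]⟩ ?_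
    refine isSquare_prod_adicCompletion_of_isoClass S Q hQ hQS hQ4 hiso8 hisoS ((Finset.erase_subset _ _).trans hA) ?_ v hvS
    rw [Finset.card_erase_of_mem hqA]
    rcases Nat.even_or_odd A.card with he | ho
    · exact absurd he hAodd
    · have hpos : 0 < A.card := Finset.card_pos.mpr ⟨q₀, hqA⟩
      obtain ⟨r, hr⟩ := ho; exact ⟨r, by omega⟩
  · rw [← Finset.prod_insert hqA]
    refine isSquare_prod_adicCompletion_of_isoClass S Q hQ hQS hQ4 hiso8 hisoS (Finset.insert_subset hq₀Q hA) ?_ v hvS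
    rw [Finset.card_insert_of_notMem hqA, Nat.even_add_one]
    exact hAodd

/-- **THE BASE PAIR `(w₁, w₂)` of the odd classes** (see the module docstring).
[cite: KlagsbrunMazurRubin2013, Thm. 3.9] [cite: Kane2013SelmerTwists, §2] -/
theorem exists_negTwist_base (h : E.toAffine.SplitTwoTorsion e₁ e₂ e₃) (h12 : e₁ < e₂) (h23 : e₂ < e₃)
    (hS : ∀ ℓ ∈ S, ℓ.Prime) (h2S : 2 ∈ S)
    (hgood : ∀ ℓ : ℕ, (hℓ : ℓ.Prime) → ℓ ∉ S → haveI : Fact ℓ.Prime := ⟨hℓ⟩;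
      padicValRat ℓ (e₁ - e₂) = 0 ∧ padicValRat ℓ (e₁ - e₃) = 0 ∧ padicValRat ℓ (e₂ - e₃) = 0)
    (hN : ∀ ℓ : ℕ, ℓ.Prime → ℓ ∉ S → ¬ ℓ ∣ E.conductorNorm ℤ)
    (hrank : E.mordellWeilRank = 0) (hsha : ∀ x ∈ E.sha, (2 : ℕ) • x = 0 → x = 0)
    (hQ : ∀ q ∈ Q, q.Prime) (hQS : ∀ q ∈ Q, q ∉ S) (hQ4 : ∀ q ∈ Q, q % 4 = 3) (hq₀Q : q₀ ∈ Q)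
    (hiso8 : ∀ q ∈ Q, ∀ q' ∈ Q, q % 8 = q' % 8)
    (hisoS : ∀ q ∈ Q, ∀ q' ∈ Q, ∀ ℓ ∈ S, (hℓ : ℓ.Prime) → ℓ ≠ 2 → haveI : Fact ℓ.Prime := ⟨hℓ⟩;
      legendreSym ℓ ((q : ℤ) * q') = 1)
    (hδ₁ : qrBit q₀ ((e₁ - e₂) * (e₁ - e₃)) = 1) (hδ₂ : qrBit q₀ ((e₂ - e₁) * (e₂ - e₃)) = 1)
    {ε : ZMod 2} (hε : qrBit q₀ (e₂ - e₁) = ε)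
    (hp₀S : p₀ ∉ S) (hp₀Q : p₀ ∉ Q) (hp8 : p₀ % 8 = 7)
    (hsplitp : ∀ ℓ ∈ S, (hℓ : ℓ.Prime) → ℓ ≠ 2 → haveI : Fact ℓ.Prime := ⟨hℓ⟩; legendreSym ℓ (-(p₀ : ℤ)) = 1) :
    ∃ w₁ w₂ : ℚˣ,
      (∀ ℓ : ℕ, (hℓ : ℓ.Prime) → ℓ ∉ S → haveI : Fact ℓ.Prime := ⟨hℓ⟩; parityBit ℓ (w₁ : ℚ) = 0 ∧ parityBit ℓ (w₂ : ℚ) = 0) ∧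
      (∀ j ∈ Q, (hj : j.Prime) → haveI : Fact j.Prime := ⟨hj⟩; qrBit j (w₁ : ℚ) = 0 ∧ qrBit j (w₂ : ℚ) = 0) ∧
      qrBit p₀ (w₁ : ℚ) = 1 ∧ qrBit p₀ (w₂ : ℚ) = 0 ∧ signBit (w₁ : ℚ) = 1 ∧ signBit (w₂ : ℚ) = 0 ∧
      (∀ (A₁ A₂ : Finset ℕ), A₁ ⊆ Q → A₂ ⊆ Q → (A₁.card : ZMod 2) = 1 + ε → (A₂.card : ZMod 2) = ε →
        ∀ (hp₁ : ∏ i ∈ A₁, (i : ℚ) ≠ 0) (hp₂ : ∏ i ∈ A₂, (i : ℚ) ≠ 0),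
        ∀ v : HeightOneSpectrum (𝓞 ℚ), natGenerator v ∈ S →
          E.twoDescentClass h (w₁ * Units.mk0 _ hp₁) (w₂ * Units.mk0 _ hp₂) ∈ selmerLocalKer E (v.adicCompletion ℚ) 2) := by
  have hq₀S : q₀ ∉ S := hQS q₀ hq₀Q
  have hq₀4 : q₀ % 4 = 3 := hQ4 q₀ hq₀Q
  obtain ⟨za, zb, hzloc, hzsupp, hpa, hpb, hra, hrb, hsa, hsb⟩ :=
    exists_relaxed_normalized E S h h12 h23 hS h2S hgood hN hrank hsha hq₀S hq₀4 hδ₁ hδ₂ hε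
  -- residues of `z` at the other rows and at `p₀`
  obtain ⟨hrowa, hp₀a⟩ := qrBit_of_supported_insert S Q hS hQ hQS hQ4 hiso8 hisoS hq₀Q hp₀S hp₀Q hp8 hsplitp za
    (fun ℓ hℓ hℓS hℓq => (hzsupp ℓ hℓ hℓS hℓq).1) hra
  obtain ⟨hrowb, hp₀b⟩ := qrBit_of_supported_insert S Q hS hQ hQS hQ4 hiso8 hisoS hq₀Q hp₀S hp₀Q hp8 hsplitp zb
    (fun ℓ hℓ hℓS hℓq => (hzsupp ℓ hℓ hℓS hℓq).2) hrb
  rw [hpa] at hrowa hp₀a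
  rw [hpb] at hrowb hp₀b
  rw [hsa] at hp₀a
  rw [hsb] at hp₀b
  have hq0 : (q₀ : ℚ) ≠ 0 := by exact_mod_cast hq₀.out.ne_zero
  have hq₀p₀ : q₀ ≠ p₀ := fun e => hp₀Q (e ▸ hq₀Q)
  -- bits of `q₀`
  have hparq_self : parityBit q₀ ((q₀ : ℕ) : ℚ) = 1 := by
    rw [parityBit, padicValRat.of_nat, padicValNat_self]; rfl
  have hparq_ne : ∀ ℓ : ℕ, (hℓ : ℓ.Prime) → ℓ ≠ q₀ → haveI : Fact ℓ.Prime := ⟨hℓ⟩; parityBit ℓ ((q₀ : ℕ) : ℚ) = 0 := by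
    intro ℓ hℓ hℓq
    haveI : Fact ℓ.Prime := ⟨hℓ⟩
    rw [parityBit, padicValRat.of_nat, padicValNat_primes hℓq]; rfl
  have hsq0 : signBit ((q₀ : ℕ) : ℚ) = 0 := (signBit_eq_zero_iff hq0).mpr (by exact_mod_cast hq₀.out.pos)
  have hz2 : ∀ x : ZMod 2, x = 0 ∨ x = 1 := by decide
  -- the base pair, by cases on `ε`
  rcases hz2 ε with e0 | e0 <;> subst e0
  · -- `ε = 0`: `w₁ = z_a q₀`, `w₂ = z_b`
    refine ⟨za * Units.mk0 _ hq0, zb, fun ℓ hℓ hℓS => ?_, fun j hj hjp => ?_, ?_, ?_, ?_, ?_, ?_⟩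
    · haveI : Fact ℓ.Prime := ⟨hℓ⟩
      rw [Units.val_mul, Units.val_mk0, parityBit_mul za.ne_zero hq0]
      by_cases hℓq : ℓ = q₀
      · subst hℓq; rw [hparq_self, hpa, hpb]; decide
      · rw [hparq_ne ℓ hℓ hℓq, add_zero]; exact hzsupp ℓ hℓ hℓS hℓq
    · haveI : Fact j.Prime := ⟨hjp⟩
      rw [Units.val_mul, Units.val_mk0]
      by_cases hjq : j = q₀
      · subst hjq
        rw [mul_comm, qrBit_natCast_mul, hra, hrb]; exact ⟨rfl, rfl⟩
      · rw [qrBit_mul j za.ne_zero hq0, hrowa j hj hjq hjp, hrowb j hj hjq hjp,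
          qrBit_natCast_prime_eq_one_add (hQ4 j hj) hq₀.out (Ne.symm hjq)]
        constructor
        · generalize (if jacobiSym (-(q₀ : ℤ)) j = -1 then (1 : ZMod 2) else 0) = x; revert x; decide
        · generalize (if jacobiSym (-(q₀ : ℤ)) j = -1 then (1 : ZMod 2) else 0) = x; revert x; decide
    · rw [Units.val_mul, Units.val_mk0, qrBit_mul p₀ za.ne_zero hq0, hp₀a,
        qrBit_natCast_prime_eq_jacobiBit hq₀.out hq₀p₀ (by omega) hq₀4]
      generalize (if jacobiSym (-(p₀ : ℤ)) q₀ = -1 then (1 : ZMod 2) else 0) = x; revert x; decide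
    · rw [hp₀b]; generalize (if jacobiSym (-(p₀ : ℤ)) q₀ = -1 then (1 : ZMod 2) else 0) = x; revert x; decide
    · rw [Units.val_mul, Units.val_mk0, signBit_mul za.ne_zero hq0, hsa, hsq0, add_zero]
    · exact hsb
    · intro A₁ A₂ hA₁ hA₂ hc₁ hc₂ hp₁ hp₂ v hvS
      have hsplit : E.twoDescentClass h (za * Units.mk0 _ hq0 * Units.mk0 _ hp₁) (zb * Units.mk0 _ hp₂) =
          E.twoDescentClass h za zb + E.twoDescentClass h (Units.mk0 _ (mul_ne_zero hq0 hp₁)) (Units.mk0 _ hp₂) := by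
        rw [← twoDescentClass_mul]
        congr 1
        exact Units.ext (by simp [mul_assoc])
      rw [hsplit]
      refine add_mem (hzloc v hvS) (twoDescentClass_mem_selmerLocalKer_of_isSquare E h _
        (charZero_of_injective_algebraMap (algebraMap ℚ _).injective) _ _ ?_ ?_)
      · rw [Units.val_mk0]
        refine isSquare_q₀_mul_prod S Q hQ hQS hQ4 hiso8 hisoS hq₀Q hA₁ ?_ v hvS
        intro hev
        rw [← ZMod.natCast_eq_zero_iff_even, hc₁] at hev
        exact absurd hev (by decide)
      · rw [Units.val_mk0]
        refine isSquare_prod_adicCompletion_of_isoClass S Q hQ hQS hQ4 hiso8 hisoS hA₂ ?_ v hvS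
        exact (ZMod.natCast_eq_zero_iff_even).mp hc₂
  · -- `ε = 1`: `w₁ = z_a`, `w₂ = z_b q₀`
    refine ⟨za, zb * Units.mk0 _ hq0, fun ℓ hℓ hℓS => ?_, fun j hj hjp => ?_, ?_, ?_, ?_, ?_, ?_⟩
    · haveI : Fact ℓ.Prime := ⟨hℓ⟩
      rw [Units.val_mul, Units.val_mk0, parityBit_mul zb.ne_zero hq0]
      by_cases hℓq : ℓ = q₀
      · subst hℓq; rw [hparq_self, hpa, hpb]; decide
      · rw [hparq_ne ℓ hℓ hℓq, add_zero]; exact hzsupp ℓ hℓ hℓS hℓq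
    · haveI : Fact j.Prime := ⟨hjp⟩
      rw [Units.val_mul, Units.val_mk0]
      by_cases hjq : j = q₀
      · subst hjq
        rw [mul_comm, qrBit_natCast_mul, hra, hrb]; exact ⟨rfl, rfl⟩
      · rw [qrBit_mul j zb.ne_zero hq0, hrowa j hj hjq hjp, hrowb j hj hjq hjp,
          qrBit_natCast_prime_eq_one_add (hQ4 j hj) hq₀.out (Ne.symm hjq)]
        constructor
        · generalize (if jacobiSym (-(q₀ : ℤ)) j = -1 then (1 : ZMod 2) else 0) = x; revert x; decide
        · generalize (if jacobiSym (-(q₀ : ℤ)) j = -1 then (1 : ZMod 2) else 0) = x; revert x; decide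
    · rw [hp₀a]; generalize (if jacobiSym (-(p₀ : ℤ)) q₀ = -1 then (1 : ZMod 2) else 0) = x; revert x; decide
    · rw [Units.val_mul, Units.val_mk0, qrBit_mul p₀ zb.ne_zero hq0, hp₀b,
        qrBit_natCast_prime_eq_jacobiBit hq₀.out hq₀p₀ (by omega) hq₀4]
      generalize (if jacobiSym (-(p₀ : ℤ)) q₀ = -1 then (1 : ZMod 2) else 0) = x; revert x; decide
    · exact hsa
    · rw [Units.val_mul, Units.val_mk0, signBit_mul zb.ne_zero hq0, hsb, hsq0, add_zero]
    · intro A₁ A₂ hA₁ hA₂ hc₁ hc₂ hp₁ hp₂ v hvS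
      have hsplit : E.twoDescentClass h (za * Units.mk0 _ hp₁) (zb * Units.mk0 _ hq0 * Units.mk0 _ hp₂) =
          E.twoDescentClass h za zb + E.twoDescentClass h (Units.mk0 _ hp₁) (Units.mk0 _ (mul_ne_zero hq0 hp₂)) := by
        rw [← twoDescentClass_mul]
        congr 1
        exact Units.ext (by simp [mul_assoc])
      rw [hsplit]
      refine add_mem (hzloc v hvS) (twoDescentClass_mem_selmerLocalKer_of_isSquare E h _
        (charZero_of_injective_algebraMap (algebraMap ℚ _).injective) _ _ ?_ ?_)
      · rw [Units.val_mk0]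
        refine isSquare_prod_adicCompletion_of_isoClass S Q hQ hQS hQ4 hiso8 hisoS hA₁ ?_ v hvS
        rw [← ZMod.natCast_eq_zero_iff_even, hc₁]; decide
      · rw [Units.val_mk0]
        refine isSquare_q₀_mul_prod S Q hQ hQS hQ4 hiso8 hisoS hq₀Q hA₂ ?_ v hvS
        intro hev
        rw [← ZMod.natCast_eq_zero_iff_even, hc₂] at hev
        exact one_ne_zero hev

end Summit.BirchSwinnertonDyer.BirchSwinnertonDyer.Theorems.GenusKolyvaginAtTwo.TorsionCellSEL

end
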